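import Summits.QuantumAdvantage.QuantumAdvantage.Theorems.PhaseDialD
import Literature.Combinatorics.Additive.TricoloredSumFreeBound

/-! # PhaseDialE — part 5/6 of the landing twins of NODE «PhaseDial» (decomp-qadv lens-2 g25; node file
`g25/PhaseDial.lean`, sha256 bb3dee64cd7f1b2c…; generator `g25/tree/gen_twins.py`: namespace `Theses.PhaseDial` →
`Theorems.PhaseDial`, cut at section boundaries (node lines 1148–1445), nothing else).
Content: §7 the 2-PRIMARY LAYER DECIDED: the LUCAS/VANDERMONDE engine for every prime (`choose_sum_mem`, `modInd_sum_mem`, `phase_val_ind_mem`, `table_mem_lowDeg'`), the characteristic-2 specialisation (`fg_twoPow_mem`) and the loss law `phase_twoPow_holds` / `phaseCell_twoPow`; `phaseCell_decided'`, `phaseLoss3_iff_open_cells'`. -/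

set_option linter.dupNamespace false
noncomputable section
open scoped Classical

namespace Summit.QuantumAdvantage.QuantumAdvantage.Theorems.PhaseDial
open Finset
open Literature.Computability.QuantumComplexity Literature.Computability.QuantumComplexity.RingHLF
open Literature.Computability.MetaComplexity Literature.Computability.MetaComplexity.Smolensky
open Summit.QuantumAdvantage.AdviceFreeQNC0
open Summit.QuantumAdvantage.QuantumAdvantage.Theorems.AnchorDial (outB dev loss_shape_mono)
open Summit.QuantumAdvantage.QuantumAdvantage.Theorems.StabilizerDial (apIdx apStrat apStrat_mem apStrat_apply pad
  pad_mem StabFew outB_pad_pad outB_pad_congr bitP_gsum gsum gsum_mem deg_gsum dev_congr eventually_polylog winset_pad)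
open Summit.QuantumAdvantage.QuantumAdvantage.Theorems.SparsityDial (real_loss_of_frac stabFew_mono_mr one_le_logpow)
open Summit.QuantumAdvantage.QuantumAdvantage.Theorems.ResponseDial (mem_dev_apStrat dev_pad_zero
  not_polylogSparse_of_agree)
open Summit.QuantumAdvantage.QuantumAdvantage.Theorems.CounterDial (CounterForm StabCounter)
open Summit.QuantumAdvantage.QuantumAdvantage.Theorems.AbelianDial (alin TableForm StabTable AbelianLoss3
  NonAbelianLoss3 tableForm_of_counterForm stabTable_of_stabCounter nT pcell qcell pcell_injective qcell_injective
  pcell_ne_qcell qG qG_apply qStrat qStrat_agree qStrat_mem6 mem_dev_q_second indB oddZeros_indB)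
open Summit.QuantumAdvantage.QuantumAdvantage.Theorems.AbelianDial (q_in_dense_class q_not_tableForm_zero
  q_not_counterForm_zero)
open Summit.QuantumAdvantage.QuantumAdvantage.Theorems.ShadowDial (aL aW aW_pos two_mul_le_two_pow aW_mul_eight aL_lt
  aL_add_three_le acell enc dcell acell_val dcell_val acell_injective dcell_injective acell_ne_dcell dcell_ne_zero
  dcell_lt_last muxStrat muxStrat_agree muxStrat_mem_logpow mem_dev_mux_second shadow shadow_pad_zero
  q_shadow_degree_linear)
open Summit.QuantumAdvantage.QuantumAdvantage.Theorems.ScaleDial (logpow_add_logpow_le)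

variable {N : ℕ}

/-! ## §7  THE 2-PRIMARY LAYER IS DECIDED: moduli `2^k` (every `r`, every `d`) — LUCAS + the same transfer

For `q = p^k` the indicator `[z ≡ c (mod q)]` of a natural-coefficient sum `z(x) = Σ_τ a_τ·x^τ` of degree-`≤ d` monomials
is `C(z(x) + s, q − 1) (mod p)` (Lucas, the tree's `natCast_choose_pow_sub_one`), and `x ↦ C(z(x) + s, L)` is an
`𝔽_p`-polynomial of degree `≤ L·d` (Vandermonde along the monomials, `choose_sum_mem`).  Hence every value indicator of
a degree-`≤ d` phase modulo `2^k` has `𝔽₂`-degree `≤ (2^k − 1)·d`, a table of `r` such phases has degree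
`≤ r·(2^k − 1)·d` (Möbius over `(Z_{2^k})^r`, `table_mem_lowDeg'`), and the modulus-`2^k` cells transfer to
`ringHardOdd_two` exactly as in §6 (`phase_twoPow_holds`).  For an ODD prime `p` the same computation lands in
`RingHardOdd p` — open for `p = 3` (it is the summit's own hardness statement): the OPEN cells of the special piece are
exactly the moduli with an odd prime factor, `d ≥ 2` — first `(2, 1, 2)` ∋ `qStrat`. -/

section TwoPow
variable {F : Type*} [Field F] {r d : ℕ}

/-- constants are of degree `0`. -/
theorem const_mem (c : F) (D : ℕ) : (fun _ : Fin N → Bool => c) ∈ lowDeg F N D := by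
  have e : (fun _ : Fin N → Bool => c) = c • (1 : CubeFn F N) := by funext x; simp
  rw [e]
  exact Submodule.smul_mem _ _ (by rw [← mono_empty (F := F)]; exact mono_mem_lowDeg (by simp))

/-- the indicator of a `d`-tuple monomial has degree `≤ d`. -/
theorem tuple_ind_mem (τ : Fin d → Fin N) :
    (fun x : Fin N → Bool => if (∀ t, x (τ t) = true) then (1 : F) else 0) ∈ lowDeg F N d := by
  have e : (fun x : Fin N → Bool => if (∀ t, x (τ t) = true) then (1 : F) else 0) = mono F (univ.image τ) := by
    funext x
    rw [mono_apply]
    have hiff : (∀ i ∈ univ.image τ, x i = true) ↔ ∀ t, x (τ t) = true := by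
      constructor
      · intro h t; exact h _ (mem_image_of_mem τ (mem_univ t))
      · intro h i hi; obtain ⟨t, -, rfl⟩ := mem_image.mp hi; exact h t
    by_cases h : ∀ t, x (τ t) = true
    · rw [if_pos h, if_pos (hiff.mpr h)]
    · rw [if_neg h, if_neg (fun h' => h (hiff.mp h'))]
  rw [e]
  exact mono_mem_lowDeg (le_trans card_image_le (by simp))

/-- `C(a·x^τ, i)` is affine in the monomial `x^τ`, hence of degree `≤ d`. -/
theorem choose_tuple_mem (τ : Fin d → Fin N) (a i : ℕ) :
    (fun x : Fin N → Bool => (((if (∀ t, x (τ t) = true) then a else 0).choose i : ℕ) : F)) ∈ lowDeg F N d := by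
  have e : (fun x : Fin N → Bool => (((if (∀ t, x (τ t) = true) then a else 0).choose i : ℕ) : F)) =
      (fun _ => ((Nat.choose 0 i : ℕ) : F)) +
        (((a.choose i : ℕ) : F) - ((Nat.choose 0 i : ℕ) : F)) • fun x => if (∀ t, x (τ t) = true) then (1 : F) else 0 := by
    funext x
    simp only [Pi.add_apply, Pi.smul_apply, smul_eq_mul]
    by_cases h : ∀ t, x (τ t) = true
    · rw [if_pos h, if_pos h]; ring
    · rw [if_neg h, if_neg h]; ring
  rw [e]
  exact Submodule.add_mem _ (const_mem _ _) (Submodule.smul_mem _ _ (tuple_ind_mem τ))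

/-- VANDERMONDE along the monomials: `x ↦ C(Σ_{τ ∈ S} a_τ x^τ + s, L)` has degree `≤ L·d`. -/
theorem choose_sum_mem (a : (Fin d → Fin N) → ℕ) (s : ℕ) (S : Finset (Fin d → Fin N)) : ∀ L : ℕ,
    (fun x : Fin N → Bool => ((((∑ τ ∈ S, if (∀ t, x (τ t) = true) then a τ else 0) + s).choose L : ℕ) : F))
      ∈ lowDeg F N (L * d) := by
  classical
  induction S using Finset.induction_on with
  | empty =>
    intro L
    simp only [sum_empty, zero_add]
    exact const_mem _ _
  | insert τ₀ S hτ ih =>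
    intro L
    have e : (fun x : Fin N → Bool =>
          ((((∑ τ ∈ insert τ₀ S, if (∀ t, x (τ t) = true) then a τ else 0) + s).choose L : ℕ) : F)) =
        ∑ ij ∈ antidiagonal L,
          (fun x : Fin N → Bool => (((if (∀ t, x (τ₀ t) = true) then a τ₀ else 0).choose ij.1 : ℕ) : F)) *
            fun x : Fin N → Bool => ((((∑ τ ∈ S, if (∀ t, x (τ t) = true) then a τ else 0) + s).choose ij.2 : ℕ) : F) := by
      funext x
      rw [Finset.sum_apply]
      simp only [Pi.mul_apply]
      rw [sum_insert hτ, add_assoc, Nat.add_choose_eq, Nat.cast_sum]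
      exact Finset.sum_congr rfl fun ij _ => by rw [Nat.cast_mul]
    rw [e]
    refine Submodule.sum_mem _ fun ij hij => ?_
    have hL : ij.1 + ij.2 = L := mem_antidiagonal.mp hij
    by_cases hi : ij.1 = 0
    · have e1 : (fun x : Fin N → Bool => (((if (∀ t, x (τ₀ t) = true) then a τ₀ else 0).choose ij.1 : ℕ) : F)) =
          fun _ => 1 := by
        funext x; rw [hi, Nat.choose_zero_right, Nat.cast_one]
      rw [e1]
      refine lowDeg_mono ?_ (mul_mem_lowDeg_add (const_mem (1 : F) 0) (ih ij.2))
      rw [zero_add]; exact Nat.mul_le_mul_right d (by omega)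
    · refine lowDeg_mono ?_ (mul_mem_lowDeg_add (choose_tuple_mem τ₀ (a τ₀) ij.1) (ih ij.2))
      have h2 : ij.2 + 1 ≤ L := by omega
      calc d + ij.2 * d = (ij.2 + 1) * d := by ring
        _ ≤ L * d := Nat.mul_le_mul_right d h2

variable {p : ℕ} [hp : Fact p.Prime]

/-- LUCAS: for `q = p^k` the indicator `[Σ_τ a_τ x^τ ≡ c (mod q)]` is an `𝔽_p`-polynomial of degree `≤ (q − 1)·d`. -/
theorem modInd_sum_mem (k : ℕ) (a : (Fin d → Fin N) → ℕ) (c : ℕ) :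
    (fun x : Fin N → Bool =>
        if (∑ τ, if (∀ t, x (τ t) = true) then a τ else 0) % p ^ k = c % p ^ k then (1 : ZMod p) else 0)
      ∈ lowDeg (ZMod p) N ((p ^ k - 1) * d) := by
  have hq0 : 0 < p ^ k := pow_pos hp.out.pos _
  have hcq : c % p ^ k < p ^ k := Nat.mod_lt _ hq0
  have key : ∀ z : ℕ, (z + (p ^ k - 1 - c % p ^ k)) % p ^ k = p ^ k - 1 ↔ z % p ^ k = c % p ^ k := by
    intro z
    have hs' : c % p ^ k + (p ^ k - 1 - c % p ^ k) = p ^ k - 1 := by omega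
    constructor
    · intro h
      have h1 : (z + (p ^ k - 1 - c % p ^ k)) % p ^ k = (c % p ^ k + (p ^ k - 1 - c % p ^ k)) % p ^ k := by
        rw [h, hs', Nat.mod_eq_of_lt (Nat.sub_lt hq0 one_pos)]
      have h2 := Nat.ModEq.add_right_cancel' (p ^ k - 1 - c % p ^ k) h1
      rw [Nat.ModEq, Nat.mod_mod] at h2
      exact h2
    · intro h
      have h1 : (z + (p ^ k - 1 - c % p ^ k)) % p ^ k = (c % p ^ k + (p ^ k - 1 - c % p ^ k)) % p ^ k := by
        have hz : z ≡ c % p ^ k [MOD p ^ k] := by rw [Nat.ModEq, h, Nat.mod_mod]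
        exact Nat.ModEq.add_right _ hz
      rw [h1, hs', Nat.mod_eq_of_lt (Nat.sub_lt hq0 one_pos)]
  have h := choose_sum_mem (F := ZMod p) a (p ^ k - 1 - c % p ^ k) univ (p ^ k - 1)
  have e : (fun x : Fin N → Bool =>
        if (∑ τ, if (∀ t, x (τ t) = true) then a τ else 0) % p ^ k = c % p ^ k then (1 : ZMod p) else 0) =
      fun x : Fin N → Bool => ((((∑ τ ∈ univ, if (∀ t, x (τ t) = true) then a τ else 0) +
        (p ^ k - 1 - c % p ^ k)).choose (p ^ k - 1) : ℕ) : ZMod p) := by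
    funext x
    rw [Literature.Combinatorics.Additive.natCast_choose_pow_sub_one]
    generalize (∑ τ : Fin d → Fin N, if (∀ t, x (τ t) = true) then a τ else 0) = z
    by_cases hz : z % p ^ k = c % p ^ k
    · rw [if_pos hz, if_pos ((key z).mpr hz)]
    · rw [if_neg hz, if_neg (fun h' => hz ((key z).mp h'))]
  rw [e]; exact h

/-- the VALUE INDICATOR of a degree-`≤ d` phase modulo `q = p^k` is an `𝔽_p`-polynomial of degree `≤ (q − 1)·d`. -/
theorem phase_val_ind_mem (k : ℕ) (w : (Fin d → Fin N) → Fin r → ZMod (p ^ k - 1 + 1)) (j : Fin r)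
    (v : ZMod (p ^ k - 1 + 1)) :
    (fun x : Fin N → Bool => if aphase (p ^ k - 1) r d w x j = v then (1 : ZMod p) else 0)
      ∈ lowDeg (ZMod p) N ((p ^ k - 1) * d) := by
  have hq1 : p ^ k - 1 + 1 = p ^ k := Nat.sub_add_cancel (Nat.one_le_pow _ _ hp.out.pos)
  have hval : ∀ x : Fin N → Bool, aphase (p ^ k - 1) r d w x j =
      (((∑ τ, if (∀ t, x (τ t) = true) then (w τ j).val else 0 : ℕ)) : ZMod (p ^ k - 1 + 1)) := by
    intro x
    unfold aphase
    rw [Nat.cast_sum]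
    refine Finset.sum_congr rfl fun τ _ => ?_
    by_cases h : ∀ t, x (τ t) = true
    · rw [if_pos h, if_pos h, ZMod.natCast_zmod_val]
    · rw [if_neg h, if_neg h, Nat.cast_zero]
  have hiff : ∀ x : Fin N → Bool, aphase (p ^ k - 1) r d w x j = v ↔
      (∑ τ, if (∀ t, x (τ t) = true) then (w τ j).val else 0) % p ^ k = v.val % p ^ k := by
    intro x
    have h := ZMod.natCast_eq_natCast_iff' (∑ τ, if (∀ t, x (τ t) = true) then (w τ j).val else 0) v.val
      (p ^ k - 1 + 1)
    have hmod : ∀ z : ℕ, z % (p ^ k - 1 + 1) = z % p ^ k := fun z => by rw [hq1]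
    rw [ZMod.natCast_zmod_val] at h
    simp only [hmod] at h
    rw [hval x, h]
  have e : (fun x : Fin N → Bool => if aphase (p ^ k - 1) r d w x j = v then (1 : ZMod p) else 0) =
      fun x : Fin N → Bool =>
        if (∑ τ, if (∀ t, x (τ t) = true) then (w τ j).val else 0) % p ^ k = v.val % p ^ k
        then (1 : ZMod p) else 0 := by
    funext x
    by_cases h : aphase (p ^ k - 1) r d w x j = v
    · rw [if_pos h, if_pos ((hiff x).mp h)]
    · rw [if_neg h, if_neg (fun h' => h ((hiff x).mpr h'))]
  rw [e]
  exact modInd_sum_mem k (fun τ => (w τ j).val) v.val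

omit hp in
/-- MÖBIUS over `R^r` (`R` finite): a Boolean table applied to `r` readouts whose VALUE INDICATORS have degree `≤ D` has
degree `≤ r·D` (`[G(z)] = Σ_u [G(u)] · Π_j [z_j = u_j]`). -/
theorem table_mem_lowDeg' {R : Type*} [Fintype R] [DecidableEq R] (G : (Fin r → R) → Bool) {D : ℕ}
    (z : Fin r → (Fin N → Bool) → R) (hz : ∀ j (v : R), (fun x => if z j x = v then (1 : F) else 0) ∈ lowDeg F N D) :
    (fun x => if G (fun j => z j x) then (1 : F) else 0) ∈ lowDeg F N (r * D) := by
  have e : (fun x => if G (fun j => z j x) then (1 : F) else 0) =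
      ∑ u : Fin r → R, (if G u then (1 : F) else 0) • ∏ j : Fin r, (fun x => if z j x = u j then (1 : F) else 0) := by
    funext x
    simp only [Finset.sum_apply, Pi.smul_apply, Finset.prod_apply, smul_eq_mul]
    rw [Finset.sum_eq_single (fun j => z j x)]
    · rw [Finset.prod_eq_one (fun j _ => if_pos rfl), mul_one]
    · intro u _ hu
      obtain ⟨j, hj⟩ : ∃ j, z j x ≠ u j := by
        by_contra hc
        exact hu (funext fun j => (not_ne_iff.mp (not_exists.mp hc j)).symm)
      rw [Finset.prod_eq_zero (mem_univ j) (if_neg hj), mul_zero]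
    · intro hu; exact absurd (mem_univ _) hu
  rw [e]
  refine Submodule.sum_mem _ fun u _ => Submodule.smul_mem _ _ ?_
  have h := prod_mem_lowDeg₂ (univ : Finset (Fin r)) (fun j => fun x => if z j x = u j then (1 : F) else 0)
    (fun j _ => hz j (u j))
  rw [card_univ, Fintype.card_fin] at h
  exact h

omit hp in
/-- the would-be output bit `G_k(phases(x)) ⊕ t_k(x)` under phase form `(m, r, d)`, as an `𝔽₂` cube function … -/
def fg (m : ℕ) (w : Fin N → (Fin d → Fin N) → Fin r → ZMod (m + 1)) (G : Fin N → (Fin r → ZMod (m + 1)) → Bool)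
    (k : Fin N) : CubeFn (ZMod 2) N :=
  fun x => ι₂ (xor (G k (aphase m r d (w k) x)) (tGuess x k))

omit hp in
/-- … AGREES with the true output bit on every odd input (any modulus) … -/
theorem fg_agree {m : ℕ} {w : Fin N → (Fin d → Fin N) → Fin r → ZMod (m + 1)}
    {G : Fin N → (Fin r → ZMod (m + 1)) → Bool} {Q : Fin N → CubeFn (ZMod 3) N} (hF : PhaseForm m r d w G Q)
    (x : Fin N → Bool) (hx : OddZeros x) (k : Fin N) : decide (fg m w G k x = 1) = decide (Q k x = 1) := by
  have h := hF x hx k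
  simp only [Summit.QuantumAdvantage.QuantumAdvantage.Theorems.AnchorDial.dev, mem_filter, mem_univ, true_and] at h
  unfold fg ι₂
  revert h
  generalize G k (aphase m r d (w k) x) = g
  generalize tGuess x k = t
  generalize decide (Q k x = 1) = q
  cases g <;> cases t <;> cases q <;> decide

omit hp in
/-- … and for modulus `2^k` has `𝔽₂`-degree `≤ r·(2^k − 1)·d + 1`. -/
theorem fg_twoPow_mem (k : ℕ) (w : Fin N → (Fin d → Fin N) → Fin r → ZMod (2 ^ k - 1 + 1))
    (G : Fin N → (Fin r → ZMod (2 ^ k - 1 + 1)) → Bool) (i : Fin N) :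
    fg (2 ^ k - 1) w G i ∈ lowDeg (ZMod 2) N (r * ((2 ^ k - 1) * d) + 1) := by
  have e : fg (2 ^ k - 1) w G i =
      (fun x => if G i (fun j => (fun y => aphase (2 ^ k - 1) r d (w i) y j) x) then (1 : ZMod 2) else 0) +
        (mono (ZMod 2) {i} + mono (ZMod 2) {nxt i}) := by
    funext x
    simp only [fg, Pi.add_apply, mono_apply, mem_singleton, forall_eq]
    unfold tGuess
    rw [ι₂_xor, ι₂_xor]
    rfl
  rw [e]
  exact Submodule.add_mem _ (lowDeg_mono (Nat.le_succ _)
      (table_mem_lowDeg' (G i) _ fun j v => phase_val_ind_mem (p := 2) k (w i) j v))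
    (lowDeg_mono (show 1 ≤ r * ((2 ^ k - 1) * d) + 1 by omega)
      (Submodule.add_mem _ (mono_mem_lowDeg (by simp)) (mono_mem_lowDeg (by simp))))

omit hp in
/-- ★★★ **THE 2-PRIMARY LAYER IS A THEOREM**: cheaply `(2^k − 1, r, d)`-phase-form strategies (tables of `r` degree-`≤ d`
phases modulo `2^k`, after a cheap gauge) lose a constant fraction of the odd class — every `k, r, d`, every gauge
exponent, no other hypothesis. -/
theorem phase_twoPow_holds (k r d : ℕ) : ∃ C : ℕ, ∀ e : ℕ, ∃ n₀ : ℕ, ∀ n ≥ n₀, ∀ P : Fin n → CubeFn (ZMod 3) n,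
    StabPhase (2 ^ k - 1) r d e P →
      ((univ.filter fun x : Fin n → Bool => OddZeros x ∧ Rel x (fun i => decide (P i x = 1))).card : ℝ)
        ≤ (1 - 1 / (n : ℝ) ^ C) * (2 : ℝ) ^ (n - 1) := by
  obtain ⟨θ, hθ, hall⟩ := ringHardOdd_two
  obtain ⟨M, hM⟩ := exists_nat_ge (1 / (1 - θ))
  refine ⟨1, fun e => ?_⟩
  obtain ⟨n₀, hn₀⟩ := hall 1
  refine ⟨max n₀ (max M (2 ^ (r * ((2 ^ k - 1) * d) + 1))), fun n hn P hst => ?_⟩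
  have hn₀' : n₀ ≤ n := le_trans (le_max_left _ _) hn
  have hM' : M ≤ n := le_trans (le_trans (le_max_left _ _) (le_max_right _ _)) hn
  have h2 : 2 ^ (r * ((2 ^ k - 1) * d) + 1) ≤ n := le_trans (le_trans (le_max_right _ _) (le_max_right _ _)) hn
  have hn1 : 1 ≤ n := le_trans Nat.one_le_two_pow h2
  have hlog : r * ((2 ^ k - 1) * d) + 1 ≤ (Nat.log 2 n) ^ 1 := by
    rw [pow_one]; exact Nat.le_log_of_pow_le (by norm_num) h2
  obtain ⟨s, -, w, G, hF⟩ := hst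
  have h := hn₀ n hn₀' (fun i => fg (2 ^ k - 1) w G i) (fun i => lowDeg_mono hlog (fg_twoPow_mem k w G i))
  have hset : (univ.filter fun x : Fin n → Bool => OddZeros x ∧ Rel x (fun i => decide (fg (2 ^ k - 1) w G i x = 1)))
      = univ.filter fun x : Fin n → Bool => OddZeros x ∧ Rel x (fun i => decide (P i x = 1)) := by
    rw [← winset_pad P s]
    refine Finset.filter_congr fun x _ => and_congr_right fun hx => ?_
    rw [show (fun i => decide (fg (2 ^ k - 1) w G i x = 1)) = (fun i => decide (pad P s i x = 1)) from
      funext fun i => fg_agree hF x hx i]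
  rw [hset] at h
  have hθn : θ ≤ 1 - 1 / (n : ℝ) ^ 1 := by
    rw [pow_one]
    have h1θ : 0 < 1 - θ := by linarith
    have hnpos : (0 : ℝ) < n := by exact_mod_cast (show 0 < n by omega)
    have hMr : 1 / (1 - θ) ≤ (n : ℝ) := le_trans hM (by exact_mod_cast hM')
    rw [div_le_iff₀ h1θ] at hMr
    have h3 : 1 / (n : ℝ) ≤ 1 - θ := by
      rw [div_le_iff₀ hnpos]; linarith
    linarith
  exact le_trans h (mul_le_mul_of_nonneg_right hθn (by positivity))

omit hp in
/-- ★ every MODULUS-`2^k` CELL of the special piece holds. -/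
theorem phaseCell_twoPow (k r d : ℕ) : PhaseCell (2 ^ k - 1) r d := by
  obtain ⟨C, hC⟩ := phase_twoPow_holds k r d
  refine ⟨0, 0, 0, C, fun c => ?_⟩
  obtain ⟨n₀, h⟩ := hC (c + 1)
  exact ⟨n₀, fun n hn P _ _ _ _ hφ => h n hn P hφ⟩

omit hp in
/-- ★ **THE CELL MAP, FINAL FORM**: a cell holds whenever `d ≤ 1` (trivially) or the modulus `m + 1` is a POWER OF TWO
(the 2-primary theorem); the special piece REDUCES to its cells with `d ≥ 2` and a modulus that is not a power of two
(i.e. has an odd prime factor) — first `(2, 1, 2)` ∋ `qStrat`. -/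
theorem phaseCell_decided' (m r d : ℕ) (h : d ≤ 1 ∨ ∃ k, m + 1 = 2 ^ k) : PhaseCell m r d := by
  rcases h with h | ⟨k, hk⟩
  · exact phaseCell_decided m r d (Or.inl h)
  · have hm : m = 2 ^ k - 1 := by omega
    subst hm
    exact phaseCell_twoPow k r d

omit hp in
/-- ★ the special piece is EQUIVALENT to the conjunction of its cells with `d ≥ 2` and a modulus that is not a power of two. -/
theorem phaseLoss3_iff_open_cells' :
    PhaseLoss3 ↔ ∀ m r d : ℕ, 2 ≤ d → (∀ k, m + 1 ≠ 2 ^ k) → PhaseCell m r d := by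
  rw [phaseLoss3_iff]
  refine ⟨fun h m r d _ _ => h m r d, fun h m r d => ?_⟩
  by_cases hd : 2 ≤ d
  · by_cases hm : ∀ k, m + 1 ≠ 2 ^ k
    · exact h m r d hd hm
    · obtain ⟨k, hk⟩ : ∃ k, m + 1 = 2 ^ k := by
        by_contra hc
        exact hm fun k hk => hc ⟨k, hk⟩
      exact phaseCell_decided' m r d (Or.inr ⟨k, hk⟩)
  · exact phaseCell_decided' m r d (Or.inl (by omega))

end TwoPow

end Summit.QuantumAdvantage.QuantumAdvantage.Theorems.PhaseDial
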